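import Summits.QuantumFields.QCD.Theses.PauliWegnerSea
import Literature.MathematicalPhysics.QuantumFieldTheory.StrongCouplingActivities
import Literature.MathematicalPhysics.QuantumFieldTheory.QCDPhaseQuenched

/-!
# Stub `stub_actionLipschitz` of crux `TiltedFlatness` (stmt-QuantumFields-14070)

Line `circle-transport`: the Wilson action is Lipschitz along a one-link circle.

We prove that the Wilson action of `SU(3)` lattice gauge theory on the torus `(ℤ/L)^4` is
Lipschitz, with an absolute constant `K = 960`, along the one-link circle move
`s ↦ U[e ↦ A·T(s)·B]`, where `T(s) = diag(e^{is}, e^{-is}, 1)`: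
`|S_W(U[e ↦ A T(s) B]) - S_W(U[e ↦ A T(s') B])| ≤ K |s - s'|`, uniformly in `L`, `U`, `e`, `A`, `B`.

## Proof

* Only plaquettes based in the shadow `edgeShadow {e}` of the moved link see it: the Wilson
  action splits as `shadowAction + bulkAction` (`wilsonAction_eq_shadowAction_add_bulkAction`)
  and the bulk parts of the two configurations agree (`bulkAction_congr`); the shadow has at most
  `5` sites (`card_edgeShadow_le`), hence at most `5 · 16 = 80` shadow plaquettes.
* For one plaquette, `|Re tr M - Re tr M'| ≤ 3 ‖M - M'‖` in the `L²` operator norm (entries are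
  bounded by the operator norm), and the holonomy `U₁ U₂ U₃⋆ U₄⋆` is a product of four unitaries
  each of which is either unchanged or changed from `g = A T(s) B` to `g' = A T(s') B`; telescoping
  in the C⋆-norm (unitaries are isometric multipliers) gives `‖hol - hol'‖ ≤ 4 ‖g - g'‖`.
* `‖g - g'‖ = ‖T(s) - T(s')‖ = ‖diag(e^{is} - e^{is'}, e^{-is} - e^{-is'}, 0)‖ ≤ |s - s'|`
  (`Matrix.l2_opNorm_diagonal`, `‖e^{ix} - 1‖ ≤ |x|`).
* Assembling: `K = 80 · 3 · 4 = 960`.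

Sources: E. Seiler, LNP 159 (1982) Ch. 1 (the Wilson action is a sum of bounded smooth plaquette
terms, each reading four links); standard.
-/

noncomputable section

namespace Summit.QuantumFields.QCD.Theorems.CircleTransport

open scoped BigOperators Real Matrix.Norms.L2Operator
open MeasureTheory Set Filter
open Literature.MathematicalPhysics.QuantumFieldTheory Literature.MathematicalPhysics.QuantumLattice
  Literature.Probability.LatticeModels

/-- `SU(3)` (the tree's `Matrix.specialUnitaryGroup (Fin 3) ℂ`). -/
local notation "SU3" => Matrix.specialUnitaryGroup (Fin 3) ℂ

/-- `s ↦ e^{is}` is `1`-Lipschitz: `‖e^{ix} - e^{iy}‖ ≤ |x - y|`. -/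
private theorem norm_cexp_mul_I_sub_le (x y : ℝ) :
    ‖Complex.exp (x * Complex.I) - Complex.exp (y * Complex.I)‖ ≤ |x - y| := by
  have h : Complex.exp (x * Complex.I) - Complex.exp (y * Complex.I) =
      Complex.exp (y * Complex.I) * (Complex.exp (Complex.I * ((x - y : ℝ) : ℂ)) - 1) := by
    rw [mul_sub, mul_one, ← Complex.exp_add]
    congr 1
    push_cast
    ring_nf
  rw [h, norm_mul, Complex.norm_exp_ofReal_mul_I, one_mul]
  exact (Real.norm_exp_I_mul_ofReal_sub_one_le).trans (le_of_eq (Real.norm_eq_abs _))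

/-- The diagonal circle `T(s) = diag(e^{is}, e^{-is}, 1)` is `1`-Lipschitz in the `L²` operator
norm: `‖T(s) - T(s')‖ ≤ |s - s'|`. -/
private theorem norm_circle_sub_le (T : ℝ → SU3)
    (hT : ∀ θ : ℝ, ((T θ : SU3) : Matrix (Fin 3) (Fin 3) ℂ) =
      Matrix.diagonal ![Complex.exp (θ * Complex.I), Complex.exp (-(θ * Complex.I)), 1])
    (s s' : ℝ) : ‖((T s : SU3) : Matrix (Fin 3) (Fin 3) ℂ) - (T s' : SU3)‖ ≤ |s - s'| := by
  rw [hT, hT, Matrix.diagonal_sub, Matrix.l2_opNorm_diagonal]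
  refine (pi_norm_le_iff_of_nonneg (abs_nonneg _)).2 fun k => ?_
  fin_cases k
  · simpa using norm_cexp_mul_I_sub_le s s'
  · have h := norm_cexp_mul_I_sub_le (-s) (-s')
    rw [show -s - -s' = -(s - s') by ring, abs_neg] at h
    simpa using h
  · simp

/-- Entries of a `3 × 3` complex matrix are bounded by its `L²` operator norm. -/
private theorem norm_entry_le_l2op (M : Matrix (Fin 3) (Fin 3) ℂ) (a b : Fin 3) :
    ‖M a b‖ ≤ ‖M‖ := by
  have h := Matrix.l2_opNorm_mulVec M (EuclideanSpace.single b (1 : ℂ))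
  rw [PiLp.norm_single, norm_one, mul_one] at h
  refine le_trans ?_ h
  have h2 := PiLp.norm_apply_le
    ((EuclideanSpace.equiv (Fin 3) ℂ).symm (M.mulVec (EuclideanSpace.single b (1 : ℂ)))) a
  have h3 : ((EuclideanSpace.equiv (Fin 3) ℂ).symm
      (M.mulVec (EuclideanSpace.single b (1 : ℂ)))) a = M a b := by
    rw [PiLp.coe_symm_continuousLinearEquiv, PiLp.toLp_apply, PiLp.ofLp_single,
      Matrix.mulVec_single_one]
    rfl
  rw [h3] at h2
  exact h2

/-- `|Re tr M - Re tr M'| ≤ 3 ‖M - M'‖` for `3 × 3` complex matrices in the `L²` operator norm. -/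
private theorem abs_re_trace_sub_le (M M' : Matrix (Fin 3) (Fin 3) ℂ) :
    |M.trace.re - M'.trace.re| ≤ 3 * ‖M - M'‖ := by
  rw [← Complex.sub_re, ← Matrix.trace_sub]
  refine (Complex.abs_re_le_norm _).trans ?_
  rw [Matrix.trace, Fin.sum_univ_three, Matrix.diag_apply, Matrix.diag_apply, Matrix.diag_apply]
  refine (norm_add₃_le).trans ?_
  have h0 := norm_entry_le_l2op (M - M') 0 0
  have h1 := norm_entry_le_l2op (M - M') 1 1
  have h2 := norm_entry_le_l2op (M - M') 2 2
  linarith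

/-- In a C⋆-ring, a telescoping bound for the difference of two fourfold products whose factors
are unitary: `‖abcd - a'b'c'd'‖ ≤ ‖a - a'‖ + ‖b - b'‖ + ‖c - c'‖ + ‖d - d'‖`. -/
private theorem norm_mul₄_sub_mul₄_le {E : Type*} [NormedRing E] [StarRing E] [CStarRing E]
    {a b c d a' b' c' d' : E} (hb : b ∈ unitary E) (hc : c ∈ unitary E) (hd : d ∈ unitary E)
    (ha' : a' ∈ unitary E) (hb' : b' ∈ unitary E) (hc' : c' ∈ unitary E) :
    ‖a * b * c * d - a' * b' * c' * d'‖ ≤ ‖a - a'‖ + ‖b - b'‖ + ‖c - c'‖ + ‖d - d'‖ := by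
  have h : a * b * c * d - a' * b' * c' * d' = (a - a') * b * c * d + a' * (b - b') * c * d +
      a' * b' * (c - c') * d + a' * b' * c' * (d - d') := by noncomm_ring
  have h1 : ‖(a - a') * b * c * d‖ = ‖a - a'‖ := by
    rw [CStarRing.norm_mul_mem_unitary _ hd, CStarRing.norm_mul_mem_unitary _ hc,
      CStarRing.norm_mul_mem_unitary _ hb]
  have h2 : ‖a' * (b - b') * c * d‖ = ‖b - b'‖ := by
    rw [CStarRing.norm_mul_mem_unitary _ hd, CStarRing.norm_mul_mem_unitary _ hc,
      CStarRing.norm_mem_unitary_mul _ ha']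
  have h3 : ‖a' * b' * (c - c') * d‖ = ‖c - c'‖ := by
    rw [CStarRing.norm_mul_mem_unitary _ hd, CStarRing.norm_mem_unitary_mul _ (mul_mem ha' hb')]
  have h4 : ‖a' * b' * c' * (d - d')‖ = ‖d - d'‖ := by
    rw [CStarRing.norm_mem_unitary_mul _ (mul_mem (mul_mem ha' hb') hc')]
  rw [h]
  refine (norm_add_le _ _).trans ?_
  rw [h4]
  refine add_le_add ((norm_add₃_le).trans ?_) le_rfl
  rw [h1, h2, h3]

/-- Replacing the variable `g` on one link `e` by `g'` moves (the fundamental representation of)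
every plaquette holonomy by at most `4 ‖g - g'‖` in the `L²` operator norm. -/
private theorem norm_holonomy_update_sub_le {L : ℕ} (U : GaugeConfig 4 L SU3) (e : Edge 4 L)
    (g g' : SU3) (x : Site 4 L) (i j : Fin 4) :
    ‖(fundamentalRep (Fin 3)) (plaquetteHolonomy (Function.update U e g) x i j) -
        (fundamentalRep (Fin 3)) (plaquetteHolonomy (Function.update U e g') x i j)‖ ≤
      4 * ‖(g : Matrix (Fin 3) (Fin 3) ℂ) - (g' : SU3)‖ := by
  have hmem : ∀ W : SU3, (W : Matrix (Fin 3) (Fin 3) ℂ) ∈ unitary (Matrix (Fin 3) (Fin 3) ℂ) :=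
    fun W => W.2.1
  have hlink : ∀ e' : Edge 4 L,
      ‖((Function.update U e g e' : SU3) : Matrix (Fin 3) (Fin 3) ℂ) -
          (Function.update U e g' e' : SU3)‖ ≤ ‖(g : Matrix (Fin 3) (Fin 3) ℂ) - (g' : SU3)‖ := by
    intro e'
    by_cases h : e' = e
    · subst h
      rw [Function.update_self, Function.update_self]
    · rw [Function.update_of_ne h, Function.update_of_ne h, sub_self, norm_zero]
      exact norm_nonneg _
  simp only [fundamentalRep_apply, plaquetteHolonomy, Submonoid.coe_mul, ← Matrix.star_eq_inv,
    Matrix.specialUnitaryGroup.coe_star]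
  refine (norm_mul₄_sub_mul₄_le (hmem _) (Unitary.star_mem (hmem _)) (Unitary.star_mem (hmem _))
    (hmem _) (hmem _) (Unitary.star_mem (hmem _))).trans ?_
  rw [← star_sub, norm_star, ← star_sub, norm_star]
  linarith [hlink (x, i), hlink (x.shift i, j), hlink (x.shift j, i), hlink (x, j)]

/-- At most `80` plaquettes of the torus `(ℤ/L)^4` are based in the shadow of one link. -/
private theorem card_shadow_plaquettes_le {L : ℕ} [NeZero L] (e : Edge 4 L) :
    (Finset.univ.filter fun p : Plaquette 4 L => p.1 ∈ edgeShadow {e}).card ≤ 80 := by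
  have hset : Finset.univ.filter (fun p : Plaquette 4 L => p.1 ∈ edgeShadow {e}) =
      edgeShadow {e} ×ˢ Finset.univ := by
    ext p; simp
  rw [hset, Finset.card_product, Finset.card_univ]
  have h1 : (edgeShadow ({e} : Finset (Edge 4 L))).card ≤ 5 := by
    simpa using card_edgeShadow_le ({e} : Finset (Edge 4 L))
  have h2 : Fintype.card {q : Fin 4 × Fin 4 // q.1 < q.2} ≤ 16 :=
    (Fintype.card_subtype_le _).trans (by simp)
  calc _ ≤ 5 * 16 := Nat.mul_le_mul h1 h2
    _ = 80 := by norm_num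

/-- STUB 2 (L, size S–M): the Wilson action is `K`-Lipschitz along the circle at one link, `L ≥ 4`. -/
theorem stub_actionLipschitz : ∀ T : ℝ → SU3,
    (∀ θ : ℝ, ((T θ : SU3) : Matrix (Fin 3) (Fin 3) ℂ) =
      Matrix.diagonal ![Complex.exp (θ * Complex.I), Complex.exp (-(θ * Complex.I)), 1]) →
    ∃ K : ℝ, 0 ≤ K ∧ ∀ (L : ℕ) [NeZero L], 4 ≤ L →
      ∀ (U : GaugeConfig 4 L SU3) (e : Edge 4 L) (A B : SU3) (s s' : ℝ),
      |wilsonAction (fundamentalRep (Fin 3)) (Function.update U e (A * T s * B)) -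
          wilsonAction (fundamentalRep (Fin 3)) (Function.update U e (A * T s' * B))| ≤ K * |s - s'| := by
  intro T hT
  refine ⟨960, by norm_num, fun L _ _hL U e A B s s' => ?_⟩
  set ρ : SU3 →* Matrix (Fin 3) (Fin 3) ℂ := fundamentalRep (Fin 3) with hρ
  set V : GaugeConfig 4 L SU3 := Function.update U e (A * T s * B) with hV
  set V' : GaugeConfig 4 L SU3 := Function.update U e (A * T s' * B) with hV'
  -- the moved link: `‖g - g'‖ ≤ |s - s'|`
  have hg : ‖((A * T s * B : SU3) : Matrix (Fin 3) (Fin 3) ℂ) - (A * T s' * B : SU3)‖ ≤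
      |s - s'| := by
    have hmul : ((A * T s * B : SU3) : Matrix (Fin 3) (Fin 3) ℂ) - (A * T s' * B : SU3) =
        (A : Matrix (Fin 3) (Fin 3) ℂ) * ((T s : SU3) - (T s' : SU3) : Matrix (Fin 3) (Fin 3) ℂ) *
          (B : Matrix (Fin 3) (Fin 3) ℂ) := by
      simp only [Submonoid.coe_mul]
      noncomm_ring
    rw [hmul, CStarRing.norm_mul_mem_unitary _ B.2.1, CStarRing.norm_mem_unitary_mul _ A.2.1]
    exact norm_circle_sub_le T hT s s'
  -- per-plaquette bound
  have hper : ∀ p : Plaquette 4 L,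
      |plaquetteCost ρ V p - plaquetteCost ρ V' p| ≤ 12 * |s - s'| := by
    intro p
    unfold plaquetteCost
    rw [sub_sub_sub_cancel_left]
    refine (abs_re_trace_sub_le _ _).trans ?_
    have h := norm_holonomy_update_sub_le U e (A * T s' * B) (A * T s * B) p.1 p.2.1.1 p.2.1.2
    rw [← norm_neg, neg_sub] at hg
    linarith
  -- only the shadow plaquettes differ
  have hVV' : ∀ e' ∉ ({e} : Finset (Edge 4 L)), V e' = V' e' := by
    intro e' he'
    rw [Finset.mem_singleton] at he'
    simp only [hV, hV', Function.update_of_ne he']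
  rw [wilsonAction_eq_shadowAction_add_bulkAction ρ (edgeShadow {e}) V,
    wilsonAction_eq_shadowAction_add_bulkAction ρ (edgeShadow {e}) V', bulkAction_congr ρ hVV',
    add_sub_add_right_eq_sub]
  unfold shadowAction
  rw [← Finset.sum_sub_distrib]
  refine (Finset.abs_sum_le_sum_abs _ _).trans ?_
  refine (Finset.sum_le_sum fun p _ => hper p).trans ?_
  rw [Finset.sum_const, nsmul_eq_mul]
  have hcard :
      ((Finset.univ.filter fun p : Plaquette 4 L => p.1 ∈ edgeShadow {e}).card : ℝ) ≤ 80 := by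
    exact_mod_cast card_shadow_plaquettes_le e
  nlinarith [abs_nonneg (s - s')]

end Summit.QuantumFields.QCD.Theorems.CircleTransport
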